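import HarnessLib
import Summits.CriticalPhenomena.Ising3DConformalLimit.Theorems.HyperoctahedralRPTwoPointKernelOfLimitClauses

/-!
# Vague asymptotic isotropy of the critical `ℤ³` two-point function, XVI:
# translation and hyperoctahedral invariance of a POINTWISE partial scaling limit
(route HarmonicMomentsIsotropy, support item stmt-CriticalPhenomena-6036 `TwoPointAsymptoticIsotropy`;
second file of the pointwise line: item stmt-CriticalPhenomena-6153 `PointwiseLimit` ⇒ item 6036)

Pointwise forms of file X (`…ArityLimit`): the hypothesis is only the POINTWISE convergence of the
rescaled `n`-point correlator at every non-coincident configuration,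
`∀ x ∈ NonCoincident 3 n, Tendsto (fun δ => rescaledCorrelator (criticalCorr 3) ρ n δ x) (𝓝[>] 0) (𝓝 (Sₙ x))`
(one `n`, any renormalisation `ρ`). The proofs of translation invariance (`limit_translate_pt`) and of
invariance under coordinate permutations, sign flips and signed permutations (`limit_coordPerm_pt`,
`limit_signFlip_pt`, `limit_signedPerm_pt`) in the tree files `…/FreeTranslations`, `…/FreePermutations`,
`…/FreeReflections`, `…KernelOfLimitClauses` use the convergence only pointwise (two configurations at a
time, along the meshes `t/(k+1)`), so they go through verbatim. (Continuity does NOT: it needs local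
uniformity, and is recovered for pair limits in file XVII from homogeneity and MMS monotonicity.) The
kernel corollary `kernel_signedPerm_pt` (`S₂(0, R y) = S₂(0, y)` for signed permutations `R`) reduces the
study of the pointwise kernel to the closed positive orthant.

References: S. Friedli, Y. Velenik, *Statistical Mechanics of Lattice Systems* (CUP 2017), Thm. 3.17
and Exercise 3.14 [FriedliVelenik2017]. No definitions are introduced.
-/

noncomputable section

namespace Summit.CriticalPhenomena.Ising3DConformalLimit.HarmonicMomentsIsotropyTwoPoint

open Literature.Probability.LatticeModels Filter Set
open scoped Topology
open Summit.CriticalPhenomena.Ising3DConformalLimit.MoebiusLimitExistsNegative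
open Summit.CriticalPhenomena.Ising3DConformalLimit.RotationUpgradeFromTwoPointNegative
open Summit.CriticalPhenomena.Ising3DConformalLimit.HyperoctahedralRPTwoPoint

variable {ρ : ℝ → ℝ} {n : ℕ} {Sn : (Fin n → EuclideanSpace ℝ (Fin 3)) → ℝ}

/-! ### Translation invariance of a pointwise one-arity limit -/

/-- Translation by `t·m̂`, `t > 0`, `m ∈ ℤ³`: `Sₙ(x + t m̂) = Sₙ(x)` on `NonCoincident`, for a pointwise
limit of the `n`-point correlators alone. [cite: FriedliVelenik2017, Thm. 3.17] -/
theorem limit_translate_pos_pt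
    (hlim : ∀ x ∈ NonCoincident 3 n, Tendsto (fun δ => rescaledCorrelator (criticalCorr 3) ρ n δ x)
      (𝓝[>] (0:ℝ)) (𝓝 (Sn x)))
    {x : Fin n → EuclideanSpace ℝ (Fin 3)} (hx : x ∈ NonCoincident 3 n) (m : Site 3) {t : ℝ}
    (ht : 0 < t) :
    Sn (fun i => x i + t • siteVec m) = Sn x := by
  have hxv : (fun i => x i + t • siteVec m) ∈ NonCoincident 3 n := (add_mem_nonCoincident_iff _ x).2 hx
  have h1 := (hlim _ hxv).comp (tendsto_div_succ_nhdsGT ht)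
  have h2 := (hlim _ hx).comp (tendsto_div_succ_nhdsGT ht)
  refine tendsto_nhds_unique h1 (h2.congr fun k => ?_)
  simp only [Function.comp_apply]
  rw [rescaledCorrelator_apply, rescaledCorrelator_apply]
  congr 1
  have hδ : 0 < t / ((k:ℝ) + 1) := by positivity
  have hcfg : (fun i => latticeApprox (t / ((k:ℝ) + 1)) (x i + t • siteVec m)) =
      fun i => latticeApprox (t / ((k:ℝ) + 1)) (x i) + ((k + 1 : ℕ) : ℤ) • m := by
    funext i
    have h := latticeApprox_add_natMul_smul hδ (x i) m (k + 1)
    have ht' : (((k + 1 : ℕ) : ℝ) * (t / ((k:ℝ) + 1))) = t := by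
      push_cast
      field_simp
    rw [ht'] at h
    exact h
  rw [hcfg]
  exact (criticalCorr_translate _ _).symm

/-- Translation by any real multiple of a lattice vector (pointwise, one arity). [cite: FriedliVelenik2017, Thm. 3.17] -/
theorem limit_translate_smul_siteVec_pt
    (hlim : ∀ x ∈ NonCoincident 3 n, Tendsto (fun δ => rescaledCorrelator (criticalCorr 3) ρ n δ x)
      (𝓝[>] (0:ℝ)) (𝓝 (Sn x)))
    {x : Fin n → EuclideanSpace ℝ (Fin 3)} (hx : x ∈ NonCoincident 3 n) (m : Site 3) (t : ℝ) :
    Sn (fun i => x i + t • siteVec m) = Sn x := by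
  rcases lt_trichotomy t 0 with ht | rfl | ht
  · have h : t • siteVec m = (-t) • siteVec (-m) := by
      ext j; simp [siteVec_apply]
    rw [h]
    exact limit_translate_pos_pt hlim hx (-m) (by linarith)
  · simp
  · exact limit_translate_pos_pt hlim hx m ht

/-- **A POINTWISE limit of the critical `n`-point correlators on `ℤ³` (one arity, any
renormalisation) is translation invariant on non-coincident configurations.**
[cite: FriedliVelenik2017, Thm. 3.17] -/
theorem limit_translate_pt
    (hlim : ∀ x ∈ NonCoincident 3 n, Tendsto (fun δ => rescaledCorrelator (criticalCorr 3) ρ n δ x)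
      (𝓝[>] (0:ℝ)) (𝓝 (Sn x)))
    (v : EuclideanSpace ℝ (Fin 3)) {x : Fin n → EuclideanSpace ℝ (Fin 3)}
    (hx : x ∈ NonCoincident 3 n) :
    Sn (fun i => x i + v) = Sn x := by
  set a : EuclideanSpace ℝ (Fin 3) := v 0 • siteVec (Pi.single 0 1 : Site 3) with ha
  set b : EuclideanSpace ℝ (Fin 3) := v 1 • siteVec (Pi.single 1 1 : Site 3) with hb
  set c : EuclideanSpace ℝ (Fin 3) := v 2 • siteVec (Pi.single 2 1 : Site 3) with hc
  have hv : v = a + b + c := by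
    ext j
    fin_cases j <;> simp [ha, hb, hc, siteVec_apply]
  have hxa : (fun i => x i + a) ∈ NonCoincident 3 n := (add_mem_nonCoincident_iff _ _).2 hx
  have hxab : (fun i => (x i + a) + b) ∈ NonCoincident 3 n := (add_mem_nonCoincident_iff _ _).2 hxa
  have hcfg : (fun i => x i + v) = fun i => ((x i + a) + b) + c := by
    funext i; rw [hv]; abel
  rw [hcfg, limit_translate_smul_siteVec_pt hlim hxab _ _,
    limit_translate_smul_siteVec_pt hlim hxa _ _, limit_translate_smul_siteVec_pt hlim hx _ _]

/-! ### Hyperoctahedral invariance of a pointwise one-arity limit -/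

/-- **A pointwise one-arity limit of the critical correlators on `ℤ³` is invariant under the
coordinate permutations of `ℝ³`** on non-coincident configurations.
[cite: FriedliVelenik2017, Exercise 3.14, p. 115] -/
theorem limit_coordPerm_pt
    (hlim : ∀ x ∈ NonCoincident 3 n, Tendsto (fun δ => rescaledCorrelator (criticalCorr 3) ρ n δ x)
      (𝓝[>] (0:ℝ)) (𝓝 (Sn x)))
    (π : Equiv.Perm (Fin 3)) {x : Fin n → EuclideanSpace ℝ (Fin 3)} (hx : x ∈ NonCoincident 3 n) :
    Sn (fun i => LinearIsometryEquiv.piLpCongrLeft 2 ℝ ℝ π (x i)) = Sn x := by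
  have hRx := (map_mem_nonCoincident_iff (LinearIsometryEquiv.piLpCongrLeft 2 ℝ ℝ π) x).2 hx
  have h1 := hlim _ hRx
  have h2 := hlim _ hx
  exact tendsto_nhds_unique (h1.congr fun δ => rescaledCorrelator_coordPerm π n δ x) h2

/-- Sign-flip invariance of a pointwise one-arity limit at a GENERIC configuration (all coordinates irrational),
along the meshes `1/(k+1)`. [cite: FriedliVelenik2017, Exercise 3.14, p. 115] -/
theorem limit_signFlip_of_irrational_pt
    (hlim : ∀ x ∈ NonCoincident 3 n, Tendsto (fun δ => rescaledCorrelator (criticalCorr 3) ρ n δ x)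
      (𝓝[>] (0:ℝ)) (𝓝 (Sn x)))
    (ε : Fin 3 → ℤˣ) (R : EuclideanSpace ℝ (Fin 3) ≃ₗᵢ[ℝ] EuclideanSpace ℝ (Fin 3))
    (hR : ∀ (p : EuclideanSpace ℝ (Fin 3)) (j : Fin 3), R p j = ((ε j : ℤ) : ℝ) * p j)
    {x : Fin n → EuclideanSpace ℝ (Fin 3)} (hx : x ∈ NonCoincident 3 n)
    (hirr : ∀ i j, Irrational (x i j)) :
    Sn (fun i => R (x i)) = Sn x := by
  have hRx := (map_mem_nonCoincident_iff R x).2 hx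
  have hmesh : Tendsto (fun k : ℕ => (1:ℝ) / ((k:ℝ) + 1)) atTop (𝓝[>] (0:ℝ)) :=
    tendsto_div_succ_nhdsGT one_pos
  have h1 := (hlim _ hRx).comp hmesh
  have h2 := (hlim _ hx).comp hmesh
  refine tendsto_nhds_unique h1 (h2.congr fun k => ?_)
  simp only [Function.comp_apply]
  rw [rescaledCorrelator_apply, rescaledCorrelator_apply]
  congr 1
  have hcfg : (fun i => latticeApprox (1 / ((k:ℝ) + 1)) (R (x i))) =
      fun i => Site.signedPerm 1 ε (latticeApprox (1 / ((k:ℝ) + 1)) (x i)) +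
        fun j => if ε j = -1 then -1 else 0 := by
    funext i; exact latticeApprox_signFlip ε R hR (hirr i) k
  rw [hcfg, criticalCorr_translate, criticalCorr_signedPerm]

/-- **A pointwise one-arity limit of the critical correlators on `ℤ³` is invariant under the
coordinate sign flips of `ℝ³`** on non-coincident configurations.
[cite: FriedliVelenik2017, Exercise 3.14, p. 115] -/
theorem limit_signFlip_pt
    (hlim : ∀ x ∈ NonCoincident 3 n, Tendsto (fun δ => rescaledCorrelator (criticalCorr 3) ρ n δ x)
      (𝓝[>] (0:ℝ)) (𝓝 (Sn x)))
    (ε : Fin 3 → ℤˣ) (R : EuclideanSpace ℝ (Fin 3) ≃ₗᵢ[ℝ] EuclideanSpace ℝ (Fin 3))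
    (hR : ∀ (p : EuclideanSpace ℝ (Fin 3)) (j : Fin 3), R p j = ((ε j : ℤ) : ℝ) * p j)
    {x : Fin n → EuclideanSpace ℝ (Fin 3)} (hx : x ∈ NonCoincident 3 n) :
    Sn (fun i => R (x i)) = Sn x := by
  obtain ⟨w, hw⟩ := exists_translate_irrational x
  have hxw : (fun i => x i + w) ∈ NonCoincident 3 n := (add_mem_nonCoincident_iff w x).2 hx
  have hRxw := (map_mem_nonCoincident_iff R (fun i => x i + w)).2 hxw
  -- `R (x i) = R (x i + w) + (-R w)`
  have hcfg : (fun i => R (x i)) = fun i => R (x i + w) + (-R w) := by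
    funext i; rw [map_add]; abel
  rw [hcfg, limit_translate_pt hlim (-R w) hRxw,
    limit_signFlip_of_irrational_pt hlim ε R hR hxw hw, limit_translate_pt hlim w hx]

/-- A pointwise one-arity limit is invariant under every signed coordinate permutation of `ℝ³`
(`(R p)_j = ε_j p_{π⁻¹ j}`) on non-coincident configurations.
[cite: FriedliVelenik2017, Exercise 3.14, p. 115] -/
theorem limit_signedPerm_pt
    (hlim : ∀ x ∈ NonCoincident 3 n, Tendsto (fun δ => rescaledCorrelator (criticalCorr 3) ρ n δ x)
      (𝓝[>] (0:ℝ)) (𝓝 (Sn x)))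
    (π : Equiv.Perm (Fin 3)) (ε : Fin 3 → ℤˣ)
    (R : EuclideanSpace ℝ (Fin 3) ≃ₗᵢ[ℝ] EuclideanSpace ℝ (Fin 3))
    (hR : ∀ (p : EuclideanSpace ℝ (Fin 3)) (j : Fin 3), R p j = ((ε j : ℤ) : ℝ) * p (π.symm j))
    {x : Fin n → EuclideanSpace ℝ (Fin 3)} (hx : x ∈ NonCoincident 3 n) :
    Sn (fun i => R (x i)) = Sn x := by
  set P := LinearIsometryEquiv.piLpCongrLeft 2 ℝ ℝ π with hP
  set Rε : EuclideanSpace ℝ (Fin 3) ≃ₗᵢ[ℝ] EuclideanSpace ℝ (Fin 3) := P.symm.trans R with hRε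
  have hPsymm : ∀ (p : EuclideanSpace ℝ (Fin 3)) (l : Fin 3), P.symm p l = p (π l) := by
    intro p l
    rw [hP, LinearIsometryEquiv.piLpCongrLeft_symm, coordPerm_apply]
    simp
  have hRε' : ∀ (p : EuclideanSpace ℝ (Fin 3)) (j : Fin 3), Rε p j = ((ε j : ℤ) : ℝ) * p j := by
    intro p j
    rw [hRε, LinearIsometryEquiv.trans_apply, hR, hPsymm, Equiv.apply_symm_apply]
  have hPx := (map_mem_nonCoincident_iff P x).2 hx
  have h1 : (fun i => R (x i)) = fun i => Rε (P (x i)) := by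
    funext i
    rw [hRε, LinearIsometryEquiv.trans_apply, LinearIsometryEquiv.symm_apply_apply]
  rw [h1, limit_signFlip_pt hlim ε Rε hRε' hPx, limit_coordPerm_pt hlim π hx]


/-! ### The pointwise pair kernel under signed permutations -/

/-- For a pointwise PAIR limit, the kernel `y ↦ S₂(0, y)` is invariant under every signed coordinate
permutation `R` of `ℝ³` (at `y = 0` trivially). [cite: FriedliVelenik2017, Exercise 3.14, p. 115] -/
theorem kernel_signedPerm_pt {ρ : ℝ → ℝ} {S2 : (Fin 2 → EuclideanSpace ℝ (Fin 3)) → ℝ}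
    (hlim : ∀ x ∈ NonCoincident 3 2, Tendsto (fun δ => rescaledCorrelator (criticalCorr 3) ρ 2 δ x)
      (𝓝[>] (0:ℝ)) (𝓝 (S2 x)))
    (π : Equiv.Perm (Fin 3)) (ε : Fin 3 → ℤˣ)
    (R : EuclideanSpace ℝ (Fin 3) ≃ₗᵢ[ℝ] EuclideanSpace ℝ (Fin 3))
    (hR : ∀ (p : EuclideanSpace ℝ (Fin 3)) (j : Fin 3), R p j = ((ε j : ℤ) : ℝ) * p (π.symm j))
    (y : EuclideanSpace ℝ (Fin 3)) :
    S2 ![0, R y] = S2 ![0, y] := by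
  by_cases hy : y = 0
  · subst hy
    simp
  have h := limit_signedPerm_pt hlim π ε R hR (zero_pair_mem_nonCoincident hy)
  rwa [comp_zeroPair (map_zero _)] at h

end Summit.CriticalPhenomena.Ising3DConformalLimit.HarmonicMomentsIsotropyTwoPoint


end
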